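import Summits.CriticalPhenomena.PercolationContinuityZ3.Theorems.PercAnnulusCrossingIICPlanarDensityMarkov
import Summits.CriticalPhenomena.PercolationContinuityZ3.Theorems.PercAnnulusCrossingIICPlanarVolume
import Mathlib.MeasureTheory.OuterMeasure.BorelCantelli
import HarnessLib

/-!
# The planar IIC has zero density ALMOST SURELY: `|C(0) ∩ Λ(n)| / |Λ(n)| → 0` `ν`-a.s. on `ℤ²` (lane RSW3, p1 gen 7)

builds on p205010 (kernel theorem, internal audit signed; external expert review pending) — not used here.

Seat `prim-rsw3-p1` (gen 7).  Conclusion of `PercAnnulusCrossingIICPlanarDensityMarkov.lean`.  For ANY probability measure `ν` with Kesten's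
IIC limit property for bond percolation on `ℤ²` at `p_c = 1/2`:

* `summable_density_tail_bound` — the tail bound `ε⁻¹(13·16^{-k} + C q^k)` of part I is summable in `k`;
* `iicMeasure_ae_eventually_density_lt_Z2` — Borel–Cantelli (`MeasureTheory.ae_eventually_notMem`): for every `ε > 0`, `ν`-a.s. eventually
  `D_{16^k} < ε |Λ(16^k)|` (`D_n = #{z ∈ Λ(n) : 0 ↔ z}`);
* **`iicMeasure_ae_tendsto_density_zero_Z2`** — `ν`-a.s. `D_n / |Λ(n)| → 0`: the fraction of the box `Λ(n)` occupied by the incipient infinite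
  cluster tends to zero almost surely (monotonicity of `D_n` and `|Λ(16^{k+1})| ≤ 256 |Λ(n)|` for `n ≥ 16^k` interpolate between the scales).
  This is the almost-sure form of the zero density of the IIC (mean form for `ℤ^d` under (A2)□: `…IICZeroDensity.lean`; planar two-point
  function: Kesten 1986 Thm. (8));
* `iicMeasure_real_volume_ge_le_Z2` — upper tightness in Kesten's Thm. (8): `ν{D_n ≥ t · n² · π_{1/2}(n)} ≤ C / t` for all `n ≥ 1`, `t > 0`
  (Markov with `E_ν D_n ≤ C n² π_{1/2}(n)` from `…IICPlanarVolume.lean`).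

Helper file for the crux `stmt-CriticalPhenomena-4575` chain; no definitions, no sorries.
References: H. Kesten, PTRF 73 (1986) 369–394, Thm. (8); G. Grimmett, *Percolation* (1999), §11.8.
-/

noncomputable section

namespace Summit.CriticalPhenomena.PercolationContinuityZ3.Theorems.Crossing

open MeasureTheory ProbabilityTheory Filter Topology
open Literature.Probability.Percolation Literature.Probability.LatticeModels
open Literature.Probability.Percolation.DCT16 Literature.Probability.Percolation.DKT20
open scoped ENNReal ProbabilityTheory Literature.Probability.Percolation

variable {d : ℕ}

/-! ## Summability of the tail bound -/

/-- The tail bound `ε⁻¹ · (13 · 16^{-k} + C · (1 − 2^{-156})^k)` is nonnegative and summable. [folklore] -/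
theorem summable_density_tail_bound (ε C : ℝ) (hε : 0 < ε) (hC : 0 ≤ C) :
    (∀ k : ℕ, 0 ≤ ε⁻¹ * (13 * ((16 : ℝ) ^ k)⁻¹ + C * (1 - (2 : ℝ)⁻¹ ^ 156) ^ k)) ∧
      Summable fun k : ℕ => ε⁻¹ * (13 * ((16 : ℝ) ^ k)⁻¹ + C * (1 - (2 : ℝ)⁻¹ ^ 156) ^ k) := by
  have hq0 : 0 ≤ 1 - (2 : ℝ)⁻¹ ^ 156 := by norm_num
  have hq1 : 1 - (2 : ℝ)⁻¹ ^ 156 < 1 := by norm_num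
  refine ⟨fun k => by positivity, ?_⟩
  refine Summable.mul_left _ (Summable.add ?_ ?_)
  · have h : (fun k : ℕ => 13 * ((16 : ℝ) ^ k)⁻¹) = fun k : ℕ => 13 * ((16 : ℝ)⁻¹) ^ k := by
      funext k; rw [inv_pow]
    rw [h]
    exact (summable_geometric_of_lt_one (by norm_num) (by norm_num)).mul_left 13
  · exact (summable_geometric_of_lt_one hq0 hq1).mul_left C

/-! ## Borel–Cantelli along the scales `16^k` -/

open Classical in
/-- **`ν`-a.s. eventually `D_{16^k} < ε |Λ(16^k)|`** (every `ε > 0`; any probability measure `ν` with Kesten's IIC limit property on `ℤ²`):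
Borel–Cantelli on the summable tail bounds of part I. [cite: Kesten1986, Thm. (8)] -/
theorem iicMeasure_ae_eventually_density_lt_Z2 {ν : Measure (BondConfig (Site 2))} [IsProbabilityMeasure ν]
    (hν : ∀ (F : Finset (Sym2 (Site 2))) (E : Set (BondConfig (Site 2))), MeasurableSet E → DeterminedBy E ↑F →
      Tendsto (fun n : ℕ => (bondPercolation (zdGraph 2) (criticalProbI 2)).real (E ∩ siteToBoundary 2 n) /
        oneArmProb 2 (criticalProbI 2) n) atTop (𝓝 (ν.real E)))
    {ε : ℝ} (hε : 0 < ε) :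
    ∀ᵐ ω ∂ν, ∀ᶠ k : ℕ in atTop,
      ((((box 2 (16 ^ k)).filter fun z => ω ∈ (openConn (0 : Site 2) z : Set (BondConfig (Site 2)))).card : ℕ) : ℝ) <
        ε * ((box 2 (16 ^ k)).card : ℝ) := by
  obtain ⟨C, hC, htail⟩ := iicMeasure_real_density_ge_le_Z2
  set E : ℕ → Set (BondConfig (Site 2)) := fun k => {ω | ε * ((box 2 (16 ^ k)).card : ℝ) ≤
    ((((box 2 (16 ^ k)).filter fun z => ω ∈ (openConn (0 : Site 2) z : Set (BondConfig (Site 2)))).card : ℕ) : ℝ)} with hE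
  set b : ℕ → ℝ := fun k => ε⁻¹ * (13 * ((16 : ℝ) ^ k)⁻¹ + C * (1 - (2 : ℝ)⁻¹ ^ 156) ^ k) with hb
  obtain ⟨hb0, hbs⟩ := summable_density_tail_bound ε C hε hC.le
  have hEk : ∀ k, ν (E k) ≤ ENNReal.ofReal (b k) := by
    intro k
    have h := htail ν hν ε hε k
    rw [← ENNReal.ofReal_toReal (measure_ne_top ν (E k))]
    exact ENNReal.ofReal_le_ofReal h
  have hsum : (∑' k, ν (E k)) ≠ ∞ := by
    have hle : (∑' k, ν (E k)) ≤ ENNReal.ofReal (∑' k, b k) := by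
      rw [ENNReal.ofReal_tsum_of_nonneg hb0 hbs]
      exact ENNReal.tsum_le_tsum hEk
    exact ne_top_of_le_ne_top ENNReal.ofReal_ne_top hle
  filter_upwards [ae_eventually_notMem hsum] with ω hω
  filter_upwards [hω] with k hk
  simp only [hE, Set.mem_setOf_eq, not_le] at hk
  exact hk

/-! ## Interpolation between the scales and the almost-sure limit -/

/-- `|Λ(16^(k+1))| ≤ 256 · |Λ(n)|` for `16^k ≤ n`. [folklore] -/
theorem card_box_pow_succ_le {k n : ℕ} (hn : 16 ^ k ≤ n) : ((box 2 (16 ^ (k + 1))).card : ℝ) ≤ 256 * ((box 2 n).card : ℝ) := by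
  rw [card_box, card_box]
  have h : 2 * 16 ^ (k + 1) + 1 ≤ 16 * (2 * n + 1) := by rw [pow_succ]; omega
  have h' : (2 * 16 ^ (k + 1) + 1) ^ 2 ≤ (16 * (2 * n + 1)) ^ 2 := Nat.pow_le_pow_left h 2
  have h'' : (16 * (2 * n + 1)) ^ 2 = 256 * (2 * n + 1) ^ 2 := by ring
  rw [h''] at h'
  exact_mod_cast h'

open Classical in
/-- **THE PLANAR IIC HAS ZERO DENSITY ALMOST SURELY**: for ANY probability measure `ν` with Kesten's IIC limit property for bond percolation on
`ℤ²` at `p_c = 1/2`, `ν`-a.s. `#{z ∈ Λ(n) : 0 ↔ z} / |Λ(n)| → 0` as `n → ∞`. [cite: Kesten1986, Thm. (8)] -/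
theorem iicMeasure_ae_tendsto_density_zero_Z2 {ν : Measure (BondConfig (Site 2))} [IsProbabilityMeasure ν]
    (hν : ∀ (F : Finset (Sym2 (Site 2))) (E : Set (BondConfig (Site 2))), MeasurableSet E → DeterminedBy E ↑F →
      Tendsto (fun n : ℕ => (bondPercolation (zdGraph 2) (criticalProbI 2)).real (E ∩ siteToBoundary 2 n) /
        oneArmProb 2 (criticalProbI 2) n) atTop (𝓝 (ν.real E))) :
    ∀ᵐ ω ∂ν, Tendsto (fun n : ℕ =>
      ((((box 2 n).filter fun z => ω ∈ (openConn (0 : Site 2) z : Set (BondConfig (Site 2)))).card : ℕ) : ℝ) /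
        ((box 2 n).card : ℝ)) atTop (𝓝 0) := by
  -- a.s. statement for the countable family `ε = 1/(j+1)`
  have hall : ∀ᵐ ω ∂ν, ∀ j : ℕ, ∀ᶠ k : ℕ in atTop,
      ((((box 2 (16 ^ k)).filter fun z => ω ∈ (openConn (0 : Site 2) z : Set (BondConfig (Site 2)))).card : ℕ) : ℝ) <
        (1 / ((j : ℝ) + 1)) * ((box 2 (16 ^ k)).card : ℝ) := by
    rw [ae_all_iff]
    intro j
    exact iicMeasure_ae_eventually_density_lt_Z2 hν (by positivity)
  filter_upwards [hall] with ω hω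
  have hcard0 : ∀ n : ℕ, (0 : ℝ) < ((box 2 n).card : ℝ) := fun n => by
    have : 0 < (box 2 n).card := Finset.card_pos.2 ⟨0, zero_mem_box 2 n⟩
    exact_mod_cast this
  rw [Metric.tendsto_atTop]
  intro δ hδ
  -- choose `j` with `256/(j+1) < δ`
  obtain ⟨j, hj⟩ := exists_nat_gt (256 / δ)
  have hj' : 256 / ((j : ℝ) + 1) < δ := by
    rw [div_lt_iff₀ (by positivity)]
    rw [div_lt_iff₀ hδ] at hj
    nlinarith
  obtain ⟨k₀, hk₀⟩ := eventually_atTop.1 (hω j)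
  refine ⟨16 ^ k₀, fun n hn => ?_⟩
  -- the scale `k` with `16^k ≤ n < 16^(k+1)`
  set k := Nat.log 16 n with hk
  have hn0 : n ≠ 0 := by
    have : 0 < 16 ^ k₀ := pow_pos (by norm_num) _
    omega
  have hkn : 16 ^ k ≤ n := Nat.pow_log_le_self 16 hn0
  have hnk : n < 16 ^ (k + 1) := Nat.lt_pow_succ_log_self (by norm_num) n
  have hk₀k : k₀ ≤ k := by
    rw [hk]
    exact Nat.le_log_of_pow_le (by norm_num) hn
  have hD := hk₀ (k + 1) (by omega)
  have hmono := card_filter_openConn_mono (d := 2) hnk.le ω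
  have hbox := card_box_pow_succ_le hkn
  rw [Real.dist_eq, sub_zero, abs_of_nonneg (div_nonneg (Nat.cast_nonneg _) (hcard0 n).le), div_lt_iff₀ (hcard0 n)]
  have hj1 : (0 : ℝ) < 1 / ((j : ℝ) + 1) := by positivity
  calc ((((box 2 n).filter fun z => ω ∈ (openConn (0 : Site 2) z : Set (BondConfig (Site 2)))).card : ℕ) : ℝ)
      ≤ ((((box 2 (16 ^ (k + 1))).filter fun z => ω ∈ (openConn (0 : Site 2) z : Set (BondConfig (Site 2)))).card : ℕ) : ℝ) := by
        exact_mod_cast hmono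
    _ ≤ (1 / ((j : ℝ) + 1)) * ((box 2 (16 ^ (k + 1))).card : ℝ) := hD.le
    _ ≤ (1 / ((j : ℝ) + 1)) * (256 * ((box 2 n).card : ℝ)) := mul_le_mul_of_nonneg_left hbox hj1.le
    _ = (256 / ((j : ℝ) + 1)) * ((box 2 n).card : ℝ) := by ring
    _ < δ * ((box 2 n).card : ℝ) := mul_lt_mul_of_pos_right hj' (hcard0 n)

/-! ## Upper tightness of `|C(0) ∩ Λ(n)| / (n² π_n)` (Kesten's Theorem (8), "moreover", upper half) -/

open Classical in
/-- **Upper tightness in Kesten's Theorem (8) on `ℤ²`**: there is `C > 0` such that for every probability measure `ν` with the IIC limit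
property at `p_c(ℤ²)`, every `n ≥ 1` and every `t > 0`, `ν{D_n ≥ t · n² · π_{1/2}(n)} ≤ C / t` (`D_n = #{z ∈ Λ(n) : 0 ↔ z}`) — Markov and
`E_ν D_n ≤ C n² π_{1/2}(n)` (`iicMeasure_sum_openConn_asymp_Z2`). [cite: Kesten1986, Thm. (8)] -/
theorem iicMeasure_real_volume_ge_le_Z2 :
    ∃ C : ℝ, 0 < C ∧ ∀ (ν : Measure (BondConfig (Site 2))) [IsProbabilityMeasure ν],
      (∀ (F : Finset (Sym2 (Site 2))) (E : Set (BondConfig (Site 2))), MeasurableSet E → DeterminedBy E ↑F →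
        Tendsto (fun n : ℕ => (bondPercolation (zdGraph 2) (criticalProbI 2)).real (E ∩ siteToBoundary 2 n) /
          oneArmProb 2 (criticalProbI 2) n) atTop (𝓝 (ν.real E))) →
      ∀ n : ℕ, 1 ≤ n → ∀ t : ℝ, 0 < t →
        ν.real {ω | t * (n : ℝ) ^ 2 * oneArmProb 2 (criticalProbI 2) n ≤
            ((((box 2 n).filter fun z => ω ∈ (openConn (0 : Site 2) z : Set (BondConfig (Site 2)))).card : ℕ) : ℝ)} ≤ C / t := by
  obtain ⟨c, C, hc, hC, hvol⟩ := iicMeasure_sum_openConn_asymp_Z2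
  obtain ⟨c₁, hc₁, hfloor⟩ := exists_oneArmProb_criticalProbI_lower_half (d := 2) le_rfl
  refine ⟨C, hC, fun ν _ hν n hn t ht => ?_⟩
  have hn0 : (0 : ℝ) < n := by exact_mod_cast hn
  -- `π(n) > 0` by the BK floor
  have hπ : 0 < oneArmProb 2 (criticalProbI 2) n :=
    lt_of_lt_of_le (div_pos hc₁ (Real.rpow_pos_of_pos hn0 _)) (hfloor n hn)
  have hs : 0 < t * (n : ℝ) ^ 2 * oneArmProb 2 (criticalProbI 2) n := by positivity
  calc ν.real {ω | t * (n : ℝ) ^ 2 * oneArmProb 2 (criticalProbI 2) n ≤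
          ((((box 2 n).filter fun z => ω ∈ (openConn (0 : Site 2) z : Set (BondConfig (Site 2)))).card : ℕ) : ℝ)}
      ≤ (∑ z ∈ box 2 n, ν.real (openConn (0 : Site 2) z)) / (t * (n : ℝ) ^ 2 * oneArmProb 2 (criticalProbI 2) n) :=
        real_card_filter_openConn_ge_le_sum_div ν n hs
    _ ≤ C * (n : ℝ) ^ 2 * oneArmProb 2 (criticalProbI 2) n / (t * (n : ℝ) ^ 2 * oneArmProb 2 (criticalProbI 2) n) :=
        div_le_div_of_nonneg_right (hvol ν hν n hn).2 hs.le
    _ = C / t := by field_simp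

end Summit.CriticalPhenomena.PercolationContinuityZ3.Theorems.Crossing

end
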